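import Mathlib
import Summits.KontsevichZagierPeriods.Zeta5Search.BigPrimeWindowCritical
import Summits.KontsevichZagierPeriods.Zeta5Search.BigPrimeNineEndCongruence
import HarnessLib.Audit
import HarnessLib

/-!
# ζ(5) search — `k = 7`: the window ENDS in the two-level slot regime — SHARPNESS and the END RESIDUE `2`

Cell `pub-zeta5` (HONEST FRAMING: systematic search; no irrationality claim unless certified), family-designer
seat `fam-vwp`, generation 13 (file 13k).  OUR theorems (Summit side; coefficient arithmetic only).

The tree proves, for `b` in the Brown–Zudilin polytope of the `k = 7` family and the ends `p = d(b) + 2` (for `W`)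
and `2p = d(b) + 2` (for `U`) of the big-prime windows:
* above `b₀` (`p ≥ b₀ + 1`): `v_p(W) = 0`, `v_p(U) = 0` (`BigPrimeSharp.padicValRat_coeffW_excess_add_two`,
  `…coeffU_half_excess_add_one`) and `W ≡ U ≡ 2 (mod p)` (`BigPrimeCongruence.padicNorm_coeffW/U_sub_two_le`);
* at ONE slot level (`p ≥ b₀ + 1 − 2b₍₂₎`): `v_p(W) = 0`, `W ≡ 2`, `v_p(U) = 0` (`BigPrimeBelowB0Sharp…_of_slot`).

**THIS FILE: the same at TWO slot levels** — the regime of the tree's window law `BigPrimeWindow…_of_slots`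
(`p ≥ b₀ + 1 − b_{j₂} − b_{j₃}`), which contains the one-level regime (take `j₂ = j₃`):
* `padicValRat_coeffW_excess_add_two_of_slots`: `p ≥ 5`, `b₀ + 1 ≤ p + b_{j₂} + b_{j₃}`, `p = d(b) + 2` ⟹
  `W(b) ≠ 0 ∧ v_p(W(b)) = 0`;  `padicValRat_coeffU_half_excess_add_one_of_slots`: `2p = d(b) + 2` ⟹ the same for `U`;
* `padicNorm_coeffW_sub_two_le_of_slots`, `padicNorm_coeffU_sub_two_le_of_slots`: at these ends `‖W − 2‖_p ≤ p⁻¹`,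
  `‖U − 2‖_p ≤ p⁻¹`, i.e. `W ≡ U ≡ 2 (mod p)` (for `U` this is new already at one level).
Together with `BigPrimeWindowCritical` (the window law for every `p ≥ 5`) the `k = 7` two-level picture is now the exact
analogue of the `k = 9` one (`BigPrimeNineWindow/Residual/WindowSharp/EndCongruence`): window `[max(5, L₂), d+1]`
(`[max(5, L₂), (d+1)/2]` for `U`), both ends attained, end residue `2`.

PROOF.  `deg M2 + 6n + 5 = 8p + 2Σβ` holds EXACTLY (`natDegree_M2_eq`; the tree's `natDegree_M2_le` is attained) and
`lc(M2) = 2` (`leadingCoeff_M2`); at `p = d + 2` this is the top degree `6p − 1` for the read index `5` of `W`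
(`4p − 1`, index `3`, for `U` at `2p = d + 2`), so `Σ_{x∈𝔽_p}[X^5]M2(X+x) = lc = 2` (`BigPrimeSharp.sum_taylor_coeff_top`;
at the critical prime `p = 5` of `W` the index equals `p` and `BigPrimeNine.sum_taylor_coeff_card_top` reads
`N = M2/(X^p − X)²` instead, using `BigPrimeWindowCritical.X_pow_card_sub_X_sq_dvd_M2'`).  Hence the cleared numerator is
`Z ≡ 2·U2 ≢ 0 (mod p)`: `v_p = 0` (`padicValRat_eq_zero_of_eq`) and `‖K − 2‖_p ≤ p⁻¹` (`BigPrimeNine.padicNorm_sub_two_le`).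

EVIDENCE (exact rationals, `pub-zeta5-fam-vwp/g13/sharp7_scan.py`, `b₀ ≤ 24`): all 24,771 end instances below `b₀`
(`W`: 13,003 at one level + 1,772 two-level-only; `U`: 6,753 + 3,243) are sharp with residue `2`, `0` exceptions —
as the theorems say.
-/

noncomputable section

open Finset Polynomial

namespace Summit.KontsevichZagierPeriods.Zeta5Search.BigPrime

open Summit.KontsevichZagierPeriods.Zeta5Search.DualSeries (InBox)
open Summit.KontsevichZagierPeriods.Zeta5Search.WedgeDictionary (IsPFData coeffW coeffU coeffW_eq coeffU_eq
  exists_isPFData dOf)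

/-! ### 1. Exact degree and leading coefficient of the `k = 7` level-2 dual polynomial `M2` -/

section ModP2

variable {p : ℕ} [hp : Fact p.Prime]

/-- `deg M2 + 6n + 5 = 8p + 2Σ_j β_j` EXACTLY in the slot regime (`p ≥ 3`; the tree's `natDegree_M2_le` is attained:
every factor is a product of distinct monic linear factors).  Port of `BigPrimeNine.natDegree_M2_eq`. -/
theorem natDegree_M2_eq (hp3 : 3 ≤ p) {n : ℕ} {β : ℕ → ℕ} {j₁ j₂ j₃ : ℕ} (hj₁ : j₁ ∈ range 7)
    (hj₂ : j₂ ∈ (range 7).erase j₁) (hS : n + 1 ≤ p + 2 * β j₃) (hT : n + 1 ≤ p + β j₂ + β j₃) (h23 : β j₂ ≤ β j₃)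
    (hmin : ∀ j ∈ ((range 7).erase j₁).erase j₂, β j₃ ≤ β j) (hβ : ∀ j ∈ range 7, 2 * β j ≤ n)
    (hj₃ : 2 * β j₃ ≤ n) :
    (M2 p n β j₁ j₂ j₃).natDegree + 6 * n + 5 = 8 * p + 2 * ∑ j ∈ range 7, β j := by
  have h2z := BigPrimeNine.two_ne_zero_zmod hp3
  have hlin : (C (2 : ZMod p) * X + C (n : ZMod p)).natDegree = 1 := natDegree_linear h2z
  have hlin0 : (C (2 : ZMod p) * X + C (n : ZMod p)) ≠ 0 :=
    ne_zero_of_natDegree_gt (n := 0) (by rw [hlin]; norm_num)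
  have hmidm : (∏ s ∈ range (n + 1) \ block n (β j₁), (X + C (s : ZMod p))).Monic :=
    monic_prod_of_monic _ _ fun s _ => monic_X_add_C _
  have hKFm : ∀ βj : ℕ, (KF p n βj).Monic := fun βj => monic_prod_of_monic _ _ fun u _ => monic_X_add_C _
  have hKCm : ∀ T : Finset ℕ, (KC p T).Monic := fun T => monic_prod_of_monic _ _ fun u _ => monic_X_add_C _
  have hprodm : (∏ j ∈ ((range 7).erase j₁).erase j₂, KF p n (β j)).Monic :=
    monic_prod_of_monic _ _ fun j _ => hKFm _
  -- the polynomial middle factor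
  have hmid : (∏ s ∈ range (n + 1) \ block n (β j₁), (X + C (s : ZMod p))).natDegree = 2 * β j₁ := by
    rw [natDegree_prod_of_monic _ _ fun s _ => monic_X_add_C _]
    have hcard : #(range (n + 1) \ block n (β j₁)) = 2 * β j₁ := by
      have h1 := card_sdiff_add_card_eq_card (block_subset n (β j₁))
      rw [block, Nat.card_Icc, card_range] at h1
      have := hβ j₁ hj₁
      rw [block]
      omega
    simp only [natDegree_X_add_C, sum_const, smul_eq_mul, mul_one, hcard]
  -- every KF with block inside S'
  have hKbd : ∀ βj : ℕ, 2 * βj ≤ n → β j₃ ≤ βj → (KF p n βj).natDegree + (n + 1) = p + 2 * βj := by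
    intro βj hb h3j
    have hsub : block n βj ⊆ block n (β j₃) := block_mono h3j
    have hcard : #(blockF p n βj) = (n - βj) + 1 - βj := by
      rw [blockF, card_image_of_injOn ((cast_injOn_block hS).mono (by exact_mod_cast hsub)), block, Nat.card_Icc]
    have hdeg : (KF p n βj).natDegree = p - #(blockF p n βj) := by
      rw [KF, natDegree_prod_of_monic _ _ fun u _ => monic_X_add_C _]
      simp only [natDegree_X_add_C, sum_const, card_univ_sdiff, ZMod.card, smul_eq_mul, mul_one]
    have hle : #(blockF p n βj) ≤ p := (card_le_univ _).trans (ZMod.card p).le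
    rw [hcard] at hle
    rw [hdeg, hcard]
    omega
  have hK : ∀ j ∈ ((range 7).erase j₁).erase j₂, (KF p n (β j)).natDegree + (n + 1) = p + 2 * β j := by
    intro j hj
    have hj7 : j ∈ range 7 := (mem_erase.1 (mem_erase.1 hj).2).2
    exact hKbd (β j) (hβ j hj7) (hmin j hj)
  have hK3 : (KF p n (β j₃)).natDegree + (n + 1) = p + 2 * β j₃ := hKbd (β j₃) hj₃ le_rfl
  -- rim complements
  have hKC : ∀ T : Finset ℕ, Set.InjOn (Nat.cast : ℕ → ZMod p) (T : Set ℕ) → (KC p T).natDegree + #T = p := by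
    intro T hinj
    have hdeg : (KC p T).natDegree = p - #(T.image (Nat.cast : ℕ → ZMod p)) := by
      rw [KC, natDegree_prod_of_monic _ _ fun u _ => monic_X_add_C _]
      simp only [natDegree_X_add_C, sum_const, card_univ_sdiff, ZMod.card, smul_eq_mul, mul_one]
    rw [card_image_of_injOn hinj] at hdeg
    have : #T ≤ p := by
      rw [← card_image_of_injOn hinj]
      exact (card_le_univ _).trans (ZMod.card p).le
    omega
  have hKL := hKC _ (cast_injOn_Ico (a := β j₂) (c := β j₃) (by omega))
  have hKR := hKC _ (cast_injOn_Ioc (a := n - β j₃) (c := n - β j₂) (by omega))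
  simp only [Nat.card_Ico] at hKL
  simp only [Nat.card_Ioc] at hKR
  have hKL' : (KC p (rimL (β j₂) (β j₃))).natDegree + (β j₃ - β j₂) = p := hKL
  have hKR' : (KC p (rimR n (β j₂) (β j₃))).natDegree + (n - β j₂ - (n - β j₃)) = p := hKR
  have hKsum : (∑ j ∈ ((range 7).erase j₁).erase j₂, (KF p n (β j)).natDegree) + 5 * (n + 1) =
      5 * p + 2 * ∑ j ∈ ((range 7).erase j₁).erase j₂, β j := by
    have := sum_congr rfl hK
    rw [sum_add_distrib, sum_const, sum_add_distrib, sum_const, card_erase_of_mem hj₂, card_erase_of_mem hj₁,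
      card_range, smul_eq_mul, smul_eq_mul, ← mul_sum] at this
    omega
  have hM2 : (M2 p n β j₁ j₂ j₃).natDegree = 1 + 2 * β j₁ +
      ((∑ j ∈ ((range 7).erase j₁).erase j₂, (KF p n (β j)).natDegree) + (KF p n (β j₃)).natDegree +
        ((KC p (rimL (β j₂) (β j₃))).natDegree + (KC p (rimR n (β j₂) (β j₃))).natDegree)) := by
    rw [M2, natDegree_mul (mul_ne_zero hlin0 hmidm.ne_zero)
      ((hprodm.mul (hKFm _)).mul ((hKCm _).mul (hKCm _))).ne_zero, natDegree_mul hlin0 hmidm.ne_zero, hlin, hmid,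
      (hprodm.mul (hKFm _)).natDegree_mul ((hKCm _).mul (hKCm _)), hprodm.natDegree_mul (hKFm _),
      (hKCm _).natDegree_mul (hKCm _), natDegree_prod_of_monic _ _ fun j _ => hKFm (β j)]
  have h3 : ∑ j ∈ ((range 7).erase j₁).erase j₂, β j + β j₂ + β j₁ = ∑ j ∈ range 7, β j := by
    rw [sum_erase_add _ _ hj₂, sum_erase_add _ _ hj₁]
  omega

/-- The leading coefficient of the `k = 7` level-2 dual polynomial `M2` is `2` (`p ≥ 3`). (`private`: FILING-LANE edit, P2 g4 — the gate's statement normaliser identifies this k = 7 lemma with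
`BigPrimeNine.leadingCoeff_M2` (k = 9, a different `M2`) by short name; used only in this file.) -/
private theorem leadingCoeff_M2 (hp3 : 3 ≤ p) (n : ℕ) (β : ℕ → ℕ) (j₁ j₂ j₃ : ℕ) :
    (M2 p n β j₁ j₂ j₃).leadingCoeff = 2 := by
  have h2z := BigPrimeNine.two_ne_zero_zmod hp3
  have hmidm : (∏ s ∈ range (n + 1) \ block n (β j₁), (X + C (s : ZMod p))).Monic :=
    monic_prod_of_monic _ _ fun s _ => monic_X_add_C _
  have hKFm : ∀ βj : ℕ, (KF p n βj).Monic := fun βj => monic_prod_of_monic _ _ fun u _ => monic_X_add_C _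
  have hKCm : ∀ T : Finset ℕ, (KC p T).Monic := fun T => monic_prod_of_monic _ _ fun u _ => monic_X_add_C _
  have hprodm : (∏ j ∈ ((range 7).erase j₁).erase j₂, KF p n (β j)).Monic :=
    monic_prod_of_monic _ _ fun j _ => hKFm _
  rw [M2, leadingCoeff_mul, leadingCoeff_mul, leadingCoeff_linear h2z, hmidm.leadingCoeff,
    ((hprodm.mul (hKFm _)).mul ((hKCm _).mul (hKCm _))).leadingCoeff, mul_one, mul_one]

end ModP2

/-! ### 2. The ends of the two-level windows: sharpness and residue `2` -/

section Ends

/-- Slot bookkeeping shared by the four theorems below (`ℤ`-data ↦ `ℕ`-data). -/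
private theorem slot_data7 (b : ℕ → ℤ) {p j₁ j₂ j₃ : ℕ} (hb : InBox b) (h2 : ∀ i ∈ range 7, 2 * b (i + 1) ≤ b 0)
    (hj₂ : j₂ ∈ range 7) (hj₃ : j₃ ∈ range 7) (h12 : j₂ ≠ j₁) (hle : b (j₂ + 1) ≤ b (j₃ + 1))
    (hmin : ∀ j ∈ range 7, j ≠ j₁ → j ≠ j₂ → b (j₃ + 1) ≤ b (j + 1))
    (hpT : b 0 + 1 ≤ (p : ℤ) + b (j₂ + 1) + b (j₃ + 1)) :
    j₂ ∈ (range 7).erase j₁ ∧ (b (j₂ + 1)).toNat ≤ (b (j₃ + 1)).toNat ∧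
      (∀ j ∈ ((range 7).erase j₁).erase j₂, (b (j₃ + 1)).toNat ≤ (b (j + 1)).toNat) ∧
      (b 0).toNat + 1 ≤ p + (b (j₂ + 1)).toNat + (b (j₃ + 1)).toNat ∧
      (b 0).toNat + 1 ≤ p + 2 * (b (j₃ + 1)).toNat ∧ 2 * (b (j₃ + 1)).toNat ≤ (b 0).toNat := by
  have h02 : 0 ≤ b (j₂ + 1) := (hb.2 j₂ hj₂).1
  have h03 : 0 ≤ b (j₃ + 1) := (hb.2 j₃ hj₃).1
  have e0 : (b 0 : ℤ) = ((b 0).toNat : ℤ) := (Int.toNat_of_nonneg hb.1).symm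
  have e2 : (b (j₂ + 1) : ℤ) = ((b (j₂ + 1)).toNat : ℤ) := (Int.toNat_of_nonneg h02).symm
  have e3 : (b (j₃ + 1) : ℤ) = ((b (j₃ + 1)).toNat : ℤ) := (Int.toNat_of_nonneg h03).symm
  have h3j := h2 j₃ hj₃
  refine ⟨mem_erase.2 ⟨h12, hj₂⟩, Int.toNat_le_toNat hle, ?_, by omega, by omega, by omega⟩
  intro j hj
  have hj' := mem_erase.1 hj; have hj'' := mem_erase.1 hj'.2
  exact Int.toNat_le_toNat (hmin j hj''.2 hj''.1 hj'.1)

/-- **(W∞)₇ IS SHARP IN THE TWO-LEVEL SLOT REGIME.**  `b` in the polytope; slots `j₁` (dropped), `j₂ ≠ j₁`, `j₃` with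
`b_{j₂} ≤ b_{j₃} ≤ b_j` for `j ∉ {j₁, j₂}`; `p` prime, `p ≥ 5`, `b₀ + 1 ≤ p + b_{j₂} + b_{j₃}` and `p = d(b) + 2` ⟹
`W(b) ≠ 0 ∧ v_p(W(b)) = 0` (`deg M2 = 6p − 1` is the top degree for the read index `5`; at `p = 5` the index is critical).
With `j₂ = j₃` it contains the tree's one-level `BigPrimeBelowB0Sharp.padicValRat_coeffW_excess_add_two_of_slot`. -/
theorem padicValRat_coeffW_excess_add_two_of_slots (b : ℕ → ℤ) (p j₁ j₂ j₃ : ℕ) (hb : InBox b)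
    (h2 : ∀ i ∈ range 7, 2 * b (i + 1) ≤ b 0) (h3 : ∑ i ∈ range 7, b (i + 1) ≤ 3 * b 0)
    (hj₁ : j₁ ∈ range 7) (hj₂ : j₂ ∈ range 7) (hj₃ : j₃ ∈ range 7) (h12 : j₂ ≠ j₁)
    (hle : b (j₂ + 1) ≤ b (j₃ + 1)) (hmin : ∀ j ∈ range 7, j ≠ j₁ → j ≠ j₂ → b (j₃ + 1) ≤ b (j + 1))
    (hprime : p.Prime) (hp5 : 5 ≤ p) (hpT : b 0 + 1 ≤ (p : ℤ) + b (j₂ + 1) + b (j₃ + 1))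
    (hpd : (p : ℤ) = dOf b + 2) : coeffW b ≠ 0 ∧ padicValRat p (coeffW b) = 0 := by
  haveI : Fact p.Prime := ⟨hprime⟩
  obtain ⟨e0, hS, hβ, hS3⟩ := polytope_data b hb h2 h3
  obtain ⟨hj₂', h23, hmin', hT', hS', h3'⟩ := slot_data7 b hb h2 hj₂ hj₃ h12 hle hmin hpT
  have hpd' : p + ∑ j ∈ range 7, (b (j + 1)).toNat = 3 * (b 0).toNat + 2 := by
    have := hpd; rw [dOf, hS, e0] at this; omega
  have hhalf : ∀ j ∈ range 7, 2 * b (j + 1) ≤ b 0 + 1 := fun j hj => by have := h2 j hj; omega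
  obtain ⟨c, hc⟩ := exists_isPFData b hb (by omega)
  have hUK := U2all_mul_sum_eq b hb hhalf hc hj₁ hj₂' h23 hmin' (o := 2) (by norm_num) (by norm_num)
  rw [← coeffW_eq hc] at hUK
  refine padicValRat_eq_zero_of_eq hUK (not_dvd_U2all hprime hT' h23) ?_
  have hdeg : (M2 p (b 0).toNat (fun j => (b (j + 1)).toNat) j₁ j₂ j₃).natDegree = 6 * p - 1 := by
    have := natDegree_M2_eq (p := p) (by omega) hj₁ hj₂' hS' hT' h23 hmin' hβ h3'
    beta_reduce at this
    omega
  have hU : ((U2all (b 0).toNat (fun j => (b (j + 1)).toNat) j₂ j₃ : ℤ) : ZMod p) ≠ 0 := by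
    rw [Ne, ZMod.intCast_zmod_eq_zero_iff_dvd]; exact not_dvd_U2all hprime hT' h23
  have htwo : (2 : ZMod p) ≠ 0 := BigPrimeNine.two_ne_zero_zmod (by omega)
  rw [← ZMod.intCast_zmod_eq_zero_iff_dvd, Z2sum_cast hp5 hj₁ hj₂' hS' hT' h23 h3' hmin' (by norm_num : 5 - 2 < 4)]
  rcases (show p = 5 ∨ 5 < p by omega) with rfl | hlt
  · rw [BigPrimeNine.sum_taylor_coeff_card_top (by norm_num) _
        (X_pow_card_sub_X_sq_dvd_M2' hj₁ hj₂' hT' h23 h3' hmin') (by omega), leadingCoeff_M2 (by norm_num)]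
    exact mul_ne_zero hU htwo
  · rw [sum_taylor_coeff_top _ (5 - 2 + 2) hlt (by omega), leadingCoeff_M2 (by omega)]
    intro h
    refine mul_ne_zero hU htwo ?_
    linear_combination h

/-- **(U∞)₇ IS SHARP IN THE TWO-LEVEL SLOT REGIME**: same slots, `p ≥ 5`, `b₀ + 1 ≤ p + b_{j₂} + b_{j₃}`,
`2p = d(b) + 2` ⟹ `U(b) ≠ 0 ∧ v_p(U(b)) = 0` (`deg M2 = 4p − 1`, read index `3 < p`). -/
theorem padicValRat_coeffU_half_excess_add_one_of_slots (b : ℕ → ℤ) (p j₁ j₂ j₃ : ℕ) (hb : InBox b)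
    (h2 : ∀ i ∈ range 7, 2 * b (i + 1) ≤ b 0) (h3 : ∑ i ∈ range 7, b (i + 1) ≤ 3 * b 0)
    (hj₁ : j₁ ∈ range 7) (hj₂ : j₂ ∈ range 7) (hj₃ : j₃ ∈ range 7) (h12 : j₂ ≠ j₁)
    (hle : b (j₂ + 1) ≤ b (j₃ + 1)) (hmin : ∀ j ∈ range 7, j ≠ j₁ → j ≠ j₂ → b (j₃ + 1) ≤ b (j + 1))
    (hprime : p.Prime) (hp5 : 5 ≤ p) (hpT : b 0 + 1 ≤ (p : ℤ) + b (j₂ + 1) + b (j₃ + 1))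
    (hpd : 2 * (p : ℤ) = dOf b + 2) : coeffU b ≠ 0 ∧ padicValRat p (coeffU b) = 0 := by
  haveI : Fact p.Prime := ⟨hprime⟩
  obtain ⟨e0, hS, hβ, hS3⟩ := polytope_data b hb h2 h3
  obtain ⟨hj₂', h23, hmin', hT', hS', h3'⟩ := slot_data7 b hb h2 hj₂ hj₃ h12 hle hmin hpT
  have hpd' : 2 * p + ∑ j ∈ range 7, (b (j + 1)).toNat = 3 * (b 0).toNat + 2 := by
    have := hpd; rw [dOf, hS, e0] at this; omega
  have hhalf : ∀ j ∈ range 7, 2 * b (j + 1) ≤ b 0 + 1 := fun j hj => by have := h2 j hj; omega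
  obtain ⟨c, hc⟩ := exists_isPFData b hb (by omega)
  have hUK := U2all_mul_sum_eq b hb hhalf hc hj₁ hj₂' h23 hmin' (o := 4) (by norm_num) (by norm_num)
  rw [← coeffU_eq hc] at hUK
  refine padicValRat_eq_zero_of_eq hUK (not_dvd_U2all hprime hT' h23) ?_
  have hdeg : (M2 p (b 0).toNat (fun j => (b (j + 1)).toNat) j₁ j₂ j₃).natDegree = 4 * p - 1 := by
    have := natDegree_M2_eq (p := p) (by omega) hj₁ hj₂' hS' hT' h23 hmin' hβ h3'
    beta_reduce at this
    omega
  have hU : ((U2all (b 0).toNat (fun j => (b (j + 1)).toNat) j₂ j₃ : ℤ) : ZMod p) ≠ 0 := by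
    rw [Ne, ZMod.intCast_zmod_eq_zero_iff_dvd]; exact not_dvd_U2all hprime hT' h23
  have htwo : (2 : ZMod p) ≠ 0 := BigPrimeNine.two_ne_zero_zmod (by omega)
  rw [← ZMod.intCast_zmod_eq_zero_iff_dvd, Z2sum_cast hp5 hj₁ hj₂' hS' hT' h23 h3' hmin' (by norm_num : 5 - 4 < 4),
    sum_taylor_coeff_top _ (5 - 4 + 2) (by omega) (by omega), leadingCoeff_M2 (by omega)]
  intro h
  refine mul_ne_zero hU htwo ?_
  linear_combination h

/-- **`W(b) ≡ 2 (mod p)` AT THE END `p = d(b) + 2`, TWO-LEVEL SLOT REGIME**: same hypotheses as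
`padicValRat_coeffW_excess_add_two_of_slots` ⟹ `‖W(b) − 2‖_p ≤ p⁻¹` (the power sum equals `lc(M2) = 2` exactly and the
clearing denominator `U2` cancels: `BigPrimeNine.padicNorm_sub_two_le`).  Contains the tree's one-level
`BigPrimeBelowB0Sharp.padicNorm_coeffW_sub_two_le_of_slot` (`j₂ = j₃`) and, for `p ≥ b₀ + 1`,
`BigPrimeCongruence.padicNorm_coeffW_sub_two_le`. -/
theorem padicNorm_coeffW_sub_two_le_of_slots (b : ℕ → ℤ) (p j₁ j₂ j₃ : ℕ) (hb : InBox b)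
    (h2 : ∀ i ∈ range 7, 2 * b (i + 1) ≤ b 0) (h3 : ∑ i ∈ range 7, b (i + 1) ≤ 3 * b 0)
    (hj₁ : j₁ ∈ range 7) (hj₂ : j₂ ∈ range 7) (hj₃ : j₃ ∈ range 7) (h12 : j₂ ≠ j₁)
    (hle : b (j₂ + 1) ≤ b (j₃ + 1)) (hmin : ∀ j ∈ range 7, j ≠ j₁ → j ≠ j₂ → b (j₃ + 1) ≤ b (j + 1))
    (hprime : p.Prime) (hp5 : 5 ≤ p) (hpT : b 0 + 1 ≤ (p : ℤ) + b (j₂ + 1) + b (j₃ + 1))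
    (hpd : (p : ℤ) = dOf b + 2) : padicNorm p (coeffW b - 2) ≤ (p : ℚ)⁻¹ := by
  haveI : Fact p.Prime := ⟨hprime⟩
  obtain ⟨e0, hS, hβ, hS3⟩ := polytope_data b hb h2 h3
  obtain ⟨hj₂', h23, hmin', hT', hS', h3'⟩ := slot_data7 b hb h2 hj₂ hj₃ h12 hle hmin hpT
  have hpd' : p + ∑ j ∈ range 7, (b (j + 1)).toNat = 3 * (b 0).toNat + 2 := by
    have := hpd; rw [dOf, hS, e0] at this; omega
  have hhalf : ∀ j ∈ range 7, 2 * b (j + 1) ≤ b 0 + 1 := fun j hj => by have := h2 j hj; omega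
  obtain ⟨c, hc⟩ := exists_isPFData b hb (by omega)
  have hUK := U2all_mul_sum_eq b hb hhalf hc hj₁ hj₂' h23 hmin' (o := 2) (by norm_num) (by norm_num)
  rw [← coeffW_eq hc] at hUK
  refine BigPrimeNine.padicNorm_sub_two_le hUK (not_dvd_U2all hprime hT' h23) ?_
  have hdeg : (M2 p (b 0).toNat (fun j => (b (j + 1)).toNat) j₁ j₂ j₃).natDegree = 6 * p - 1 := by
    have := natDegree_M2_eq (p := p) (by omega) hj₁ hj₂' hS' hT' h23 hmin' hβ h3'
    beta_reduce at this
    omega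
  rw [← ZMod.intCast_zmod_eq_zero_iff_dvd]
  push_cast
  rw [Z2sum_cast hp5 hj₁ hj₂' hS' hT' h23 h3' hmin' (by norm_num : 5 - 2 < 4)]
  rcases (show p = 5 ∨ 5 < p by omega) with rfl | hlt
  · rw [BigPrimeNine.sum_taylor_coeff_card_top (by norm_num) _
        (X_pow_card_sub_X_sq_dvd_M2' hj₁ hj₂' hT' h23 h3' hmin') (by omega), leadingCoeff_M2 (by norm_num)]
    ring
  · rw [sum_taylor_coeff_top _ (5 - 2 + 2) hlt (by omega), leadingCoeff_M2 (by omega)]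
    ring

/-- **`U(b) ≡ 2 (mod p)` AT THE END `2p = d(b) + 2`, TWO-LEVEL SLOT REGIME** (`p ≥ 5`): `‖U(b) − 2‖_p ≤ p⁻¹`
(new below `b₀` already at one slot level; above `b₀` it is `BigPrimeCongruence.padicNorm_coeffU_sub_two_le`). -/
theorem padicNorm_coeffU_sub_two_le_of_slots (b : ℕ → ℤ) (p j₁ j₂ j₃ : ℕ) (hb : InBox b)
    (h2 : ∀ i ∈ range 7, 2 * b (i + 1) ≤ b 0) (h3 : ∑ i ∈ range 7, b (i + 1) ≤ 3 * b 0)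
    (hj₁ : j₁ ∈ range 7) (hj₂ : j₂ ∈ range 7) (hj₃ : j₃ ∈ range 7) (h12 : j₂ ≠ j₁)
    (hle : b (j₂ + 1) ≤ b (j₃ + 1)) (hmin : ∀ j ∈ range 7, j ≠ j₁ → j ≠ j₂ → b (j₃ + 1) ≤ b (j + 1))
    (hprime : p.Prime) (hp5 : 5 ≤ p) (hpT : b 0 + 1 ≤ (p : ℤ) + b (j₂ + 1) + b (j₃ + 1))
    (hpd : 2 * (p : ℤ) = dOf b + 2) : padicNorm p (coeffU b - 2) ≤ (p : ℚ)⁻¹ := by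
  haveI : Fact p.Prime := ⟨hprime⟩
  obtain ⟨e0, hS, hβ, hS3⟩ := polytope_data b hb h2 h3
  obtain ⟨hj₂', h23, hmin', hT', hS', h3'⟩ := slot_data7 b hb h2 hj₂ hj₃ h12 hle hmin hpT
  have hpd' : 2 * p + ∑ j ∈ range 7, (b (j + 1)).toNat = 3 * (b 0).toNat + 2 := by
    have := hpd; rw [dOf, hS, e0] at this; omega
  have hhalf : ∀ j ∈ range 7, 2 * b (j + 1) ≤ b 0 + 1 := fun j hj => by have := h2 j hj; omega
  obtain ⟨c, hc⟩ := exists_isPFData b hb (by omega)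
  have hUK := U2all_mul_sum_eq b hb hhalf hc hj₁ hj₂' h23 hmin' (o := 4) (by norm_num) (by norm_num)
  rw [← coeffU_eq hc] at hUK
  refine BigPrimeNine.padicNorm_sub_two_le hUK (not_dvd_U2all hprime hT' h23) ?_
  have hdeg : (M2 p (b 0).toNat (fun j => (b (j + 1)).toNat) j₁ j₂ j₃).natDegree = 4 * p - 1 := by
    have := natDegree_M2_eq (p := p) (by omega) hj₁ hj₂' hS' hT' h23 hmin' hβ h3'
    beta_reduce at this
    omega
  rw [← ZMod.intCast_zmod_eq_zero_iff_dvd]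
  push_cast
  rw [Z2sum_cast hp5 hj₁ hj₂' hS' hT' h23 h3' hmin' (by norm_num : 5 - 4 < 4),
    sum_taylor_coeff_top _ (5 - 4 + 2) (by omega) (by omega), leadingCoeff_M2 (by omega)]
  ring

end Ends

/-- Audit: the two critical-top budgets used above (`p² + p − 1` at `p = 5` is `29 = 6·5 − 1`). -/
example : 2 * 5 + ((5 - 2) + (5 - 2 + 1) * (5 - 1)) = 6 * 5 - 1 := by norm_num

end Summit.KontsevichZagierPeriods.Zeta5Search.BigPrime

end
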